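import Summits.Parity.BatemanHorn.Theorems.SoloInformedTwinUnbalancedSmallClass
import Literature.NumberTheory.Sieve.BombieriFriedlanderIwaniecBoxes

/-!
# The unbalanced twin sum, regime (1b) — I: `(1+Δ)`-adic boxes in the cofactor and the variable

Soloist file (informed mode), first file of step F4 (the bilinear regime) of the kernel project
for (F′).  For a configuration `(lo, hi, r₀, a)`, a modulus `q` and the cofactors `K₀ < k ≤ K`, the
class sums `innerP(q,k)` of packaging P (`SoloInformedTwinUnbalancedSmallClass`) are cut into the
product boxes `k ∈ (K(1+Δ)^{-i-1}, K(1+Δ)^{-i}]`, `e ∈ (hi(1+Δ)^{-l-1}, hi(1+Δ)^{-l}]` (`BFI.InBox`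
of `BombieriFriedlanderIwaniecBoxes`): `card_filter_mul_zmod_eq_le` (a dilated reduced class meets
`[u, v]` in `≤ (v − u)/q + 1` integers), `boxSum` / `freeSum` (box sums with / without the cuts
`e > y/q`, `ke ≤ hi`), `sum_innerP_eq_sum_boxSum` (box decomposition), `boxSum_eq_freeSum`
(interior boxes), `boxSum_eq_zero_of_le` / `boxSum_eq_zero_of_lt` (dead boxes), `abs_boxSum_le`
(trivial bound), `freeSum_eq_bilinear` (the free box sum is the bilinear class sum of
`BFI.bilinDisc` with `α = 𝟙_{k-box}`, `β =` the Möbius log-power piece on the `e`-box).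
Elementary bookkeeping only; the analytic inputs enter in the sequel files.
-/

namespace Summit.Parity.BatemanHorn.Theorems

open Finset Real
open scoped ArithmeticFunction.Moebius ArithmeticFunction.zeta
open Literature.NumberTheory.Sieve Literature.NumberTheory.Sieve.BFI

/-! ### 1. Counting a dilated reduced class in an interval -/

/-- A dilated reduced class `{e : ke ≡ a (q)}` (`(q, a) = 1`, `q ≥ 1`) meets `[u, v]` in at most
`(v − u)/q + 1` integers: two members are congruent modulo `q` (as `k` is then invertible), hence
differ by at least `q`. -/
theorem card_filter_mul_zmod_eq_le {q : ℕ} (hq : 0 < q) {a : ℤ} (ha : IsCoprime (q : ℤ) a)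
    (k : ℕ) (s : Finset ℕ) {u v : ℝ} (huv : u ≤ v) (hs : ∀ n ∈ s, u ≤ n ∧ (n : ℝ) ≤ v) :
    (#(s.filter fun e : ℕ => ((k * e : ℕ) : ZMod q) = (a : ZMod q)) : ℝ) ≤ (v - u) / q + 1 := by
  classical
  set T := s.filter (fun e : ℕ => ((k * e : ℕ) : ZMod q) = (a : ZMod q)) with hT
  have hq0 : (0 : ℝ) < q := by exact_mod_cast hq
  have hmem : ∀ n ∈ T, u ≤ n ∧ (n : ℝ) ≤ v ∧ ((k * n : ℕ) : ZMod q) = (a : ZMod q) :=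
    fun n hn => by
      rw [hT, Finset.mem_filter] at hn
      exact ⟨(hs n hn.1).1, (hs n hn.1).2, hn.2⟩
  -- two members of the class are congruent modulo `q`
  have hcong : ∀ n ∈ T, ∀ n' ∈ T, n % q = n' % q := by
    intro n hn n' hn'
    obtain ⟨-, -, h3⟩ := hmem n hn
    obtain ⟨-, -, h3'⟩ := hmem n' hn'
    have hkq : k.Coprime q := (coprime_and_coprime_of_switch_cond h3 ha).1
    have hu : IsUnit ((k : ℕ) : ZMod q) := by
      rw [← ZMod.coe_unitOfCoprime k hkq]; exact Units.isUnit _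
    have h33 : ((k : ℕ) : ZMod q) * ((n : ℕ) : ZMod q) = ((k : ℕ) : ZMod q) * ((n' : ℕ) : ZMod q) := by
      have e1 : ((k * n : ℕ) : ZMod q) = ((k * n' : ℕ) : ZMod q) := by rw [h3, h3']
      push_cast at e1
      exact e1
    exact (ZMod.natCast_eq_natCast_iff' n n' q).mp (hu.mul_left_cancel h33)
  have hmaps : ∀ n ∈ T, ⌊((n : ℝ) - u) / q⌋₊ ∈ Finset.range (⌊(v - u) / q⌋₊ + 1) := fun n hn => by
    obtain ⟨h1, h2, -⟩ := hmem n hn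
    rw [Finset.mem_range, Nat.lt_succ_iff]
    exact Nat.floor_le_floor (div_le_div_of_nonneg_right (by linarith) hq0.le)
  have hstep : ∀ n ∈ T, ∀ n' ∈ T, n < n' →
      ⌊((n : ℝ) - u) / q⌋₊ + 1 ≤ ⌊((n' : ℝ) - u) / q⌋₊ := by
    intro n hn n' hn' hlt
    obtain ⟨h1, -, -⟩ := hmem n hn
    have hmod : (n : ℤ) ≡ n' [ZMOD q] := by
      rw [Int.ModEq, ← Int.natCast_mod, ← Int.natCast_mod, hcong n hn n' hn']
    have hd : (q : ℤ) ≤ n' - n := Int.le_of_dvd (by omega) (Int.ModEq.dvd hmod)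
    have hd' : (q : ℝ) ≤ (n' : ℝ) - n := by exact_mod_cast hd
    have : ((n : ℝ) - u) / q + 1 ≤ ((n' : ℝ) - u) / q := by
      rw [div_add_one hq0.ne', div_le_div_iff_of_pos_right hq0]; linarith
    have := Nat.floor_le_floor this
    rwa [Nat.floor_add_one (div_nonneg (by linarith) hq0.le)] at this
  have hinj : Set.InjOn (fun n : ℕ => ⌊((n : ℝ) - u) / q⌋₊) T := by
    intro n hn n' hn' h
    by_contra hne
    simp only at h
    rcases lt_or_gt_of_ne hne with hlt | hlt
    · have := hstep n hn n' hn' hlt; omega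
    · have := hstep n' hn' n hn hlt; omega
  have hcard := Finset.card_le_card_of_injOn _ hmaps hinj
  rw [Finset.card_range] at hcard
  have h0 : 0 ≤ (v - u) / q := div_nonneg (by linarith) hq0.le
  calc ((T.card : ℕ) : ℝ) ≤ ((⌊(v - u) / q⌋₊ + 1 : ℕ) : ℝ) := by exact_mod_cast hcard
    _ = (⌊(v - u) / q⌋₊ : ℝ) + 1 := by push_cast; ring
    _ ≤ (v - u) / q + 1 := by linarith [Nat.floor_le h0]

/-- The integers of a box `(L, H]` (`0 ≤ L ≤ H`) inside any finite set number at most `H − L + 1`. -/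
theorem card_filter_inBox_le {T Δ : ℝ} (hT : 0 ≤ T) (hΔ : 0 ≤ Δ) (i : ℕ) (s : Finset ℕ)
    (P : ℕ → Prop) [DecidablePred P] :
    (#(s.filter fun n : ℕ => InBox T Δ i n ∧ P n) : ℝ) ≤ boxHigh T Δ i - boxLow T Δ i + 1 := by
  classical
  have hLH : boxLow T Δ i ≤ boxHigh T Δ i := by
    unfold boxLow boxHigh
    exact div_le_div_of_nonneg_left hT (by positivity) (pow_le_pow_right₀ (by linarith) (by omega))
  have hsub : s.filter (fun n : ℕ => InBox T Δ i n ∧ P n) ⊆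
      Finset.Ioc ⌊boxLow T Δ i⌋₊ ⌊boxHigh T Δ i⌋₊ := by
    intro n hn
    obtain ⟨-, ⟨hn0, hlo, hhi⟩, -⟩ := Finset.mem_filter.1 hn
    rw [Finset.mem_Ioc]
    refine ⟨(Nat.floor_lt (by unfold boxLow; positivity)).2 hlo, Nat.le_floor hhi⟩
  have h1 := Finset.card_le_card hsub
  rw [Nat.card_Ioc] at h1
  have h2 : ((⌊boxHigh T Δ i⌋₊ - ⌊boxLow T Δ i⌋₊ : ℕ) : ℝ) ≤ boxHigh T Δ i - boxLow T Δ i + 1 := by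
    have hL0 : 0 ≤ boxLow T Δ i := by unfold boxLow; positivity
    have e1 : (⌊boxHigh T Δ i⌋₊ : ℝ) ≤ boxHigh T Δ i := Nat.floor_le (hL0.trans hLH)
    have e2 : boxLow T Δ i < (⌊boxLow T Δ i⌋₊ : ℝ) + 1 := Nat.lt_floor_add_one _
    have e3 : ⌊boxLow T Δ i⌋₊ ≤ ⌊boxHigh T Δ i⌋₊ := Nat.floor_le_floor hLH
    push_cast [Nat.cast_sub e3]
    linarith
  calc (#(s.filter fun n : ℕ => InBox T Δ i n ∧ P n) : ℝ)
      ≤ ((⌊boxHigh T Δ i⌋₊ - ⌊boxLow T Δ i⌋₊ : ℕ) : ℝ) := by exact_mod_cast h1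
    _ ≤ boxHigh T Δ i - boxLow T Δ i + 1 := h2

/-! ### 2. The partition of unity by boxes -/

/-- For `Δ > 0`, `0 < T < (1+Δ)^I` and `1 ≤ n ≤ T`: `∑_{i<I} 𝟙[n ∈ box i] = 1`. -/
theorem sum_indicator_inBox_eq_one {T Δ : ℝ} (hT : 0 < T) (hΔ : 0 < Δ) {I : ℕ}
    (hI : T < (1 + Δ) ^ I) {n : ℕ} (hn1 : 1 ≤ n) (hnT : (n : ℝ) ≤ T) :
    ∑ i ∈ Finset.range I, (if InBox T Δ i n then (1 : ℝ) else 0) = 1 := by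
  have h := sum_boxRestrict_apply hT hΔ hI ((ζ : ArithmeticFunction ℕ) : ArithmeticFunction ℝ) hn1 hnT
  have hz : ((ζ : ArithmeticFunction ℕ) : ArithmeticFunction ℝ) n = 1 := by
    rw [ArithmeticFunction.natCoe_apply, ArithmeticFunction.zeta_apply_ne (by omega), Nat.cast_one]
  simpa [boxRestrict_apply, hz] using h

/-! ### 3. Box sums -/

/-- The box sum of packaging P: cofactors `k ∈ (K₀, K]` in the `i`-th box below `K` with
`(k, r₀) = 1`, variables `e ≤ hi` in the `l`-th box below `hi`, class `ke ≡ a (q)`, weight the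
Möbius log-power piece on `(y/q, hi/k]` (both cuts present). -/
noncomputable def boxSum (j r₀ hi y : ℕ) (a : ℤ) (K₀ K : ℕ) (Δ : ℝ) (q i l : ℕ) : ℝ :=
  ∑ k ∈ (Ioc K₀ K).filter (fun k : ℕ => InBox (K : ℝ) Δ i k ∧ k.Coprime r₀),
    ∑ e ∈ (Icc 1 hi).filter (fun e : ℕ => InBox (hi : ℝ) Δ l e),
      if ((k * e : ℕ) : ZMod q) = (a : ZMod q) then moebiusLogPiece j r₀ (y / q) (hi / k) e else 0

/-- The free box sum: the same without the cuts (weight the piece on `(0, hi]`). -/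
noncomputable def freeSum (j r₀ hi : ℕ) (a : ℤ) (K₀ K : ℕ) (Δ : ℝ) (q i l : ℕ) : ℝ :=
  ∑ k ∈ (Ioc K₀ K).filter (fun k : ℕ => InBox (K : ℝ) Δ i k ∧ k.Coprime r₀),
    ∑ e ∈ (Icc 1 hi).filter (fun e : ℕ => InBox (hi : ℝ) Δ l e),
      if ((k * e : ℕ) : ZMod q) = (a : ZMod q) then moebiusLogPiece j r₀ 0 hi e else 0

/-- **Box decomposition.** For `Δ > 0`, `K < (1+Δ)^I`, `hi < (1+Δ)^{I'}` and `lo ≤ K₀ + 1`: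
`∑_{K₀<k≤K} 𝟙[(k,r₀)=1] innerP(q,k) = ∑_{i<I} ∑_{l<I'} boxSum(q; i, l)`. -/
theorem sum_innerP_eq_sum_boxSum {Δ : ℝ} (hΔ : 0 < Δ) {K hi I I' : ℕ} (hK : (K : ℝ) < (1 + Δ) ^ I)
    (hhi : (hi : ℝ) < (1 + Δ) ^ I') {lo K₀ : ℕ} (hlo : lo ≤ K₀ + 1) (j r₀ y : ℕ) (a : ℤ) (q : ℕ) :
    ∑ k ∈ Ioc K₀ K, (if k.Coprime r₀ then (1 : ℝ) else 0) * innerP j r₀ lo hi y a q k =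
      ∑ i ∈ Finset.range I, ∑ l ∈ Finset.range I', boxSum j r₀ hi y a K₀ K Δ q i l := by
  classical
  set g : ℕ → ℕ → ℝ := fun k e => if ((k * e : ℕ) : ZMod q) = (a : ZMod q) then
    moebiusLogPiece j r₀ (y / q) (hi / k) e else 0 with hg
  -- Step 1: the `e`-partition inside `innerP` (and `max (y/q) ((lo-1)/k) = y/q` for `k > K₀`).
  have hinner : ∀ k ∈ Ioc K₀ K, innerP j r₀ lo hi y a q k =
      ∑ l ∈ Finset.range I', ∑ e ∈ (Icc 1 hi).filter (fun e : ℕ => InBox (hi : ℝ) Δ l e), g k e := by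
    intro k hk
    have hk0 : K₀ < k := (Finset.mem_Ioc.1 hk).1
    have hmax : max (y / q) ((lo - 1) / k) = y / q := by
      rw [Nat.div_eq_of_lt (by omega : lo - 1 < k)]; exact max_eq_left (Nat.zero_le _)
    unfold innerP
    rw [hmax]; simp_rw [Finset.sum_filter]; rw [Finset.sum_comm]
    refine Finset.sum_congr rfl fun e he => ?_
    have he1 : 1 ≤ e := (Finset.mem_Icc.1 he).1
    have hpos : 0 < hi := by have := (Finset.mem_Icc.1 he).2; omega
    have hehi : (e : ℝ) ≤ hi := by exact_mod_cast (Finset.mem_Icc.1 he).2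
    have hpart := sum_indicator_inBox_eq_one (T := (hi : ℝ)) (by exact_mod_cast hpos) hΔ hhi he1 hehi
    have hb : ∀ l : ℕ, (if InBox (hi : ℝ) Δ l e then g k e else 0) =
        (if InBox (hi : ℝ) Δ l e then (1 : ℝ) else 0) * g k e := fun l => (boole_mul _ _).symm
    show g k e = ∑ l ∈ Finset.range I', if InBox (hi : ℝ) Δ l e then g k e else 0
    rw [Finset.sum_congr rfl fun l _ => hb l, ← Finset.sum_mul, hpart, one_mul]
  -- Step 2: the `k`-partition.
  have hK1 : ∀ k ∈ Ioc K₀ K, ∑ i ∈ Finset.range I, (if InBox (K : ℝ) Δ i k then (1 : ℝ) else 0) = 1 := by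
    intro k hk
    have hk1 : 1 ≤ k := by have := (Finset.mem_Ioc.1 hk).1; omega
    have hkK : (k : ℝ) ≤ K := by exact_mod_cast (Finset.mem_Ioc.1 hk).2
    have hKpos : (0 : ℝ) < K := lt_of_lt_of_le (by exact_mod_cast hk1 : (0 : ℝ) < k) hkK
    exact sum_indicator_inBox_eq_one hKpos hΔ hK hk1 hkK
  calc ∑ k ∈ Ioc K₀ K, (if k.Coprime r₀ then (1 : ℝ) else 0) * innerP j r₀ lo hi y a q k
      = ∑ k ∈ Ioc K₀ K, ∑ i ∈ Finset.range I, (if InBox (K : ℝ) Δ i k ∧ k.Coprime r₀ then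
          ∑ l ∈ Finset.range I', ∑ e ∈ (Icc 1 hi).filter (fun e : ℕ => InBox (hi : ℝ) Δ l e), g k e
          else 0) := by
        refine Finset.sum_congr rfl fun k hk => ?_
        rw [hinner k hk]
        have : ∀ i : ℕ, (if InBox (K : ℝ) Δ i k ∧ k.Coprime r₀ then
            ∑ l ∈ Finset.range I', ∑ e ∈ (Icc 1 hi).filter (fun e : ℕ => InBox (hi : ℝ) Δ l e), g k e
            else (0 : ℝ)) =
            (if InBox (K : ℝ) Δ i k then (1 : ℝ) else 0) * ((if k.Coprime r₀ then (1 : ℝ) else 0) *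
              ∑ l ∈ Finset.range I', ∑ e ∈ (Icc 1 hi).filter (fun e : ℕ => InBox (hi : ℝ) Δ l e),
                g k e) := by
          intro i
          by_cases h1 : InBox (K : ℝ) Δ i k <;> by_cases h2 : k.Coprime r₀ <;> simp [h1, h2]
        rw [Finset.sum_congr rfl fun i _ => this i, ← Finset.sum_mul, hK1 k hk, one_mul]
    _ = ∑ i ∈ Finset.range I, ∑ k ∈ (Ioc K₀ K).filter (fun k : ℕ => InBox (K : ℝ) Δ i k ∧ k.Coprime r₀),
          ∑ l ∈ Finset.range I', ∑ e ∈ (Icc 1 hi).filter (fun e : ℕ => InBox (hi : ℝ) Δ l e), g k e := by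
        rw [Finset.sum_comm]
        simp_rw [Finset.sum_filter]
    _ = ∑ i ∈ Finset.range I, ∑ l ∈ Finset.range I', boxSum j r₀ hi y a K₀ K Δ q i l := by
        refine Finset.sum_congr rfl fun i _ => ?_
        rw [Finset.sum_comm]
        rfl

/-! ### 4. Interior and dead boxes -/

/-- `boxHigh ≤ T` for `T ≥ 0`, `Δ ≥ 0`. -/
theorem boxHigh_le_self {T Δ : ℝ} (hT : 0 ≤ T) (hΔ : 0 ≤ Δ) (i : ℕ) : boxHigh T Δ i ≤ T := by
  unfold boxHigh
  exact div_le_self hT (one_le_pow₀ (by linarith))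

/-- `boxLow ≤ boxHigh` for `T ≥ 0`, `Δ ≥ 0`. -/
theorem boxLow_le_boxHigh {T Δ : ℝ} (hT : 0 ≤ T) (hΔ : 0 ≤ Δ) (i : ℕ) : boxLow T Δ i ≤ boxHigh T Δ i := by
  unfold boxLow boxHigh
  exact div_le_div_of_nonneg_left hT (by positivity) (pow_le_pow_right₀ (by linarith) (by omega))

/-- **Interior boxes**: if `boxHigh_i · boxHigh_l ≤ hi` (the whole box lies under the hyperbola
`ke ≤ hi`) and `y/q ≤ boxLow_l` (the whole box lies beyond the cut `e > y/q`), then the two cuts are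
inactive: `boxSum(q; i, l) = freeSum(q; i, l)`. -/
theorem boxSum_eq_freeSum {Δ : ℝ} {K hi y q i l : ℕ}
    (hprod : boxHigh (K : ℝ) Δ i * boxHigh (hi : ℝ) Δ l ≤ hi)
    (hcut : ((y / q : ℕ) : ℝ) ≤ boxLow (hi : ℝ) Δ l) (j r₀ : ℕ) (a : ℤ) (K₀ : ℕ) :
    boxSum j r₀ hi y a K₀ K Δ q i l = freeSum j r₀ hi a K₀ K Δ q i l := by
  unfold boxSum freeSum
  refine Finset.sum_congr rfl fun k hk => Finset.sum_congr rfl fun e he => ?_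
  obtain ⟨-, ⟨hk0, -, hkhi⟩, -⟩ := Finset.mem_filter.1 hk
  obtain ⟨he, ⟨he0, helo, hehi⟩⟩ := Finset.mem_filter.1 he
  have hehi' : e ≤ hi := (Finset.mem_Icc.1 he).2
  have h1 : y / q < e := by
    have : ((y / q : ℕ) : ℝ) < e := hcut.trans_lt helo
    exact_mod_cast this
  have h2 : e ≤ hi / k := by
    rw [Nat.le_div_iff_mul_le hk0]
    have : (e : ℝ) * k ≤ hi :=
      calc (e : ℝ) * k ≤ boxHigh (hi : ℝ) Δ l * boxHigh (K : ℝ) Δ i :=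
            mul_le_mul hehi hkhi (Nat.cast_nonneg k) ((Nat.cast_nonneg e).trans hehi)
        _ ≤ hi := by rw [mul_comm]; exact hprod
    exact_mod_cast this
  split_ifs
  · unfold moebiusLogPiece
    simp only [h1, h2, he0, hehi', true_and]
  · rfl

/-- **Dead boxes, I**: if `boxHigh_l ≤ y/q` then every `e` of the box fails the cut `e > y/q`:
`boxSum(q; i, l) = 0`. -/
theorem boxSum_eq_zero_of_le {Δ : ℝ} {K hi y q i l : ℕ}
    (hcut : boxHigh (hi : ℝ) Δ l ≤ ((y / q : ℕ) : ℝ)) (j r₀ : ℕ) (a : ℤ) (K₀ : ℕ) :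
    boxSum j r₀ hi y a K₀ K Δ q i l = 0 := by
  unfold boxSum
  refine Finset.sum_eq_zero fun k _ => Finset.sum_eq_zero fun e he => ?_
  obtain ⟨-, ⟨-, -, hehi⟩⟩ := Finset.mem_filter.1 he
  have h1 : ¬ y / q < e := by
    rw [not_lt]; exact_mod_cast (hehi.trans hcut : (e : ℝ) ≤ ((y / q : ℕ) : ℝ))
  split_ifs
  · unfold moebiusLogPiece; rw [if_neg]; exact fun h => h1 h.1
  · rfl

/-- **Dead boxes, II**: if `hi < boxLow_i · boxLow_l` (`Δ ≥ 0`) then every `(k, e)` of the box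
has `ke > hi`: `boxSum(q; i, l) = 0`. -/
theorem boxSum_eq_zero_of_lt {Δ : ℝ} (hΔ : 0 ≤ Δ) {K hi y q i l : ℕ}
    (hprod : (hi : ℝ) < boxLow (K : ℝ) Δ i * boxLow (hi : ℝ) Δ l) (j r₀ : ℕ) (a : ℤ) (K₀ : ℕ) :
    boxSum j r₀ hi y a K₀ K Δ q i l = 0 := by
  unfold boxSum
  refine Finset.sum_eq_zero fun k hk => Finset.sum_eq_zero fun e he => ?_
  obtain ⟨-, ⟨hk0, hklo, -⟩, -⟩ := Finset.mem_filter.1 hk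
  obtain ⟨-, ⟨-, helo, -⟩⟩ := Finset.mem_filter.1 he
  have hL1 : 0 ≤ boxLow (K : ℝ) Δ i := by unfold boxLow; positivity
  have hL2 : 0 ≤ boxLow (hi : ℝ) Δ l := by unfold boxLow; positivity
  have h2 : ¬ e ≤ hi / k := by
    rw [Nat.le_div_iff_mul_le hk0, not_le]
    have : (hi : ℝ) < e * k := by
      calc (hi : ℝ) < boxLow (K : ℝ) Δ i * boxLow (hi : ℝ) Δ l := hprod
        _ < k * e := mul_lt_mul'' hklo helo hL1 hL2
        _ = e * k := mul_comm _ _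
    exact_mod_cast this
  split_ifs
  · unfold moebiusLogPiece; rw [if_neg]; exact fun h => h2 h.2.1
  · rfl

/-! ### 5. The trivial bound -/

/-- **Trivial bound for a box**: for a reduced class (`(q, a) = 1`, `q ≥ 1`) and `Δ ≥ 0`,
`|boxSum(q; i, l)| ≤ (log hi)^j · (boxHigh_i − boxLow_i + 1) · ((boxHigh_l − boxLow_l)/q + 1)`
(each `|β_e| ≤ (log hi)^j`, the class count of § 1 in the `e`-box, the integer count in the
`k`-box). -/
theorem abs_boxSum_le {Δ : ℝ} (hΔ : 0 ≤ Δ) {q : ℕ} (hq : 0 < q) {a : ℤ} (ha : IsCoprime (q : ℤ) a)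
    (j r₀ hi y K₀ K i l : ℕ) :
    |boxSum j r₀ hi y a K₀ K Δ q i l| ≤
      Real.log hi ^ j * (boxHigh (K : ℝ) Δ i - boxLow (K : ℝ) Δ i + 1) *
        ((boxHigh (hi : ℝ) Δ l - boxLow (hi : ℝ) Δ l) / q + 1) := by
  classical
  set E := (Icc 1 hi).filter (fun e : ℕ => InBox (hi : ℝ) Δ l e) with hE
  set Kb := (Ioc K₀ K).filter (fun k : ℕ => InBox (K : ℝ) Δ i k ∧ k.Coprime r₀) with hKb
  have hLH : boxLow (hi : ℝ) Δ l ≤ boxHigh (hi : ℝ) Δ l := boxLow_le_boxHigh (Nat.cast_nonneg hi) hΔ l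
  have hD : 0 ≤ (boxHigh (hi : ℝ) Δ l - boxLow (hi : ℝ) Δ l) / q + 1 := by
    have := sub_nonneg.2 hLH; positivity
  have hlog0 : 0 ≤ Real.log hi := Real.log_natCast_nonneg hi
  have hinner : ∀ k ∈ Kb,
      |∑ e ∈ E, (if ((k * e : ℕ) : ZMod q) = (a : ZMod q) then
          moebiusLogPiece j r₀ (y / q) (hi / k) e else 0)| ≤
        Real.log hi ^ j * ((boxHigh (hi : ℝ) Δ l - boxLow (hi : ℝ) Δ l) / q + 1) := by
    intro k _
    calc |∑ e ∈ E, (if ((k * e : ℕ) : ZMod q) = (a : ZMod q) then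
            moebiusLogPiece j r₀ (y / q) (hi / k) e else 0)|
        ≤ ∑ e ∈ E, |(if ((k * e : ℕ) : ZMod q) = (a : ZMod q) then
            moebiusLogPiece j r₀ (y / q) (hi / k) e else 0)| := Finset.abs_sum_le_sum_abs _ _
      _ ≤ ∑ e ∈ E, (if ((k * e : ℕ) : ZMod q) = (a : ZMod q) then Real.log hi ^ j else 0) := by
          refine Finset.sum_le_sum fun e he => ?_
          have he1 : (1 : ℝ) ≤ e := by exact_mod_cast (Finset.mem_Icc.1 (Finset.mem_filter.1 he).1).1
          have hehi : (e : ℝ) ≤ hi := by exact_mod_cast (Finset.mem_Icc.1 (Finset.mem_filter.1 he).1).2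
          split_ifs
          · calc |moebiusLogPiece j r₀ (y / q) (hi / k) e| ≤ |Real.log e| ^ j :=
                  abs_moebiusLogPiece_le _ _ _ _ _
              _ ≤ Real.log hi ^ j := by
                  rw [abs_of_nonneg (Real.log_nonneg he1)]
                  exact pow_le_pow_left₀ (Real.log_nonneg he1) (Real.log_le_log (by linarith) hehi) j
          · rw [abs_zero]
      _ = Real.log hi ^ j * #(E.filter fun e : ℕ => ((k * e : ℕ) : ZMod q) = (a : ZMod q)) := by
          rw [← Finset.sum_filter, Finset.sum_const, nsmul_eq_mul, mul_comm]
      _ ≤ Real.log hi ^ j * ((boxHigh (hi : ℝ) Δ l - boxLow (hi : ℝ) Δ l) / q + 1) := by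
          refine mul_le_mul_of_nonneg_left (card_filter_mul_zmod_eq_le hq ha k E hLH ?_) (by positivity)
          intro n hn
          obtain ⟨-, ⟨-, hlo, hhi⟩⟩ := Finset.mem_filter.1 hn
          exact ⟨hlo.le, hhi⟩
  have hcardK : (#Kb : ℝ) ≤ boxHigh (K : ℝ) Δ i - boxLow (K : ℝ) Δ i + 1 :=
    card_filter_inBox_le (T := (K : ℝ)) (Nat.cast_nonneg K) hΔ i (Ioc K₀ K) (fun k : ℕ => k.Coprime r₀)
  calc |boxSum j r₀ hi y a K₀ K Δ q i l|
      ≤ ∑ k ∈ Kb, |∑ e ∈ E, (if ((k * e : ℕ) : ZMod q) = (a : ZMod q) then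
          moebiusLogPiece j r₀ (y / q) (hi / k) e else 0)| := Finset.abs_sum_le_sum_abs _ _
    _ ≤ ∑ k ∈ Kb, Real.log hi ^ j * ((boxHigh (hi : ℝ) Δ l - boxLow (hi : ℝ) Δ l) / q + 1) :=
        Finset.sum_le_sum hinner
    _ = #Kb * (Real.log hi ^ j * ((boxHigh (hi : ℝ) Δ l - boxLow (hi : ℝ) Δ l) / q + 1)) := by
        rw [Finset.sum_const, nsmul_eq_mul]
    _ ≤ (boxHigh (K : ℝ) Δ i - boxLow (K : ℝ) Δ i + 1) *
          (Real.log hi ^ j * ((boxHigh (hi : ℝ) Δ l - boxLow (hi : ℝ) Δ l) / q + 1)) :=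
        mul_le_mul_of_nonneg_right hcardK (by positivity)
    _ = _ := by ring

/-! ### 6. The free box sum as a bilinear class sum over BFI's dyadic ranges -/

/-- A box `(boxLow, boxHigh]` with `0 ≤ Δ ≤ 1` lies in the dyadic range `n ∼ boxLow`. -/
theorem mem_dyadic_of_inBox {T Δ : ℝ} (hT : 0 ≤ T) (hΔ0 : 0 ≤ Δ) (hΔ1 : Δ ≤ 1) {i n : ℕ}
    (h : InBox T Δ i n) : n ∈ dyadic (boxLow T Δ i) := by
  have hL0 : 0 ≤ boxLow T Δ i := by unfold boxLow; positivity
  rw [mem_dyadic hL0]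
  refine ⟨h.2.1, h.2.2.trans ?_⟩
  rw [boxHigh_eq_mul_boxLow (by linarith) i]
  exact mul_le_mul_of_nonneg_right (by linarith) hL0

/-- **The free box sum is a bilinear class sum**: with `M = boxLow_i`, `N = boxLow_l`,
`α = 𝟙_{k-box ∩ (K₀,K] ∩ (k,r₀)=1}` and `β =` the Möbius log-power piece on
`(⌊boxLow_l⌋, ⌊boxHigh_l⌋]` (`0 ≤ Δ ≤ 1`),
`freeSum(q; i, l) = ∑_{m∼M} ∑_{n∼N, mn ≡ a (q)} α_m β_n` — the first term of `BFI.bilinDisc a M N α β q`. -/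
theorem freeSum_eq_bilinear {Δ : ℝ} (hΔ0 : 0 ≤ Δ) (hΔ1 : Δ ≤ 1) (j r₀ hi : ℕ) (a : ℤ)
    (K₀ K q i l : ℕ) :
    freeSum j r₀ hi a K₀ K Δ q i l =
      ∑ m ∈ dyadic (boxLow (K : ℝ) Δ i), ∑ n ∈ dyadic (boxLow (hi : ℝ) Δ l),
        if ((m * n : ℕ) : ZMod q) = (a : ZMod q) then
          (if m ∈ (Ioc K₀ K).filter (fun k : ℕ => InBox (K : ℝ) Δ i k ∧ k.Coprime r₀) then (1 : ℝ)
            else 0) *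
            moebiusLogPiece j r₀ ⌊boxLow (hi : ℝ) Δ l⌋₊ ⌊boxHigh (hi : ℝ) Δ l⌋₊ n
        else 0 := by
  classical
  set E := (Icc 1 hi).filter (fun e : ℕ => InBox (hi : ℝ) Δ l e) with hE
  set Kb := (Ioc K₀ K).filter (fun k : ℕ => InBox (K : ℝ) Δ i k ∧ k.Coprime r₀) with hKb
  have hL0 : 0 ≤ boxLow (hi : ℝ) Δ l := by unfold boxLow; positivity
  have hHhi : boxHigh (hi : ℝ) Δ l ≤ hi := boxHigh_le_self (Nat.cast_nonneg hi) hΔ0 l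
  have hKsub : Kb ⊆ dyadic (boxLow (K : ℝ) Δ i) := fun m hm =>
    mem_dyadic_of_inBox (Nat.cast_nonneg K) hΔ0 hΔ1 (Finset.mem_filter.1 hm).2.1
  have hEsub : E ⊆ dyadic (boxLow (hi : ℝ) Δ l) := fun n hn =>
    mem_dyadic_of_inBox (Nat.cast_nonneg hi) hΔ0 hΔ1 (Finset.mem_filter.1 hn).2
  -- the piece on `(⌊boxLow⌋, ⌊boxHigh⌋]` vanishes off `E` and agrees with the piece on `(0, hi]` on `E`
  have hpiece_off : ∀ n : ℕ, n ∉ E →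
      moebiusLogPiece j r₀ ⌊boxLow (hi : ℝ) Δ l⌋₊ ⌊boxHigh (hi : ℝ) Δ l⌋₊ n = 0 := by
    intro n hn
    unfold moebiusLogPiece
    rw [if_neg]
    rintro ⟨h1, h2, -⟩
    refine hn (Finset.mem_filter.2 ⟨Finset.mem_Icc.2 ⟨by omega, ?_⟩, ⟨by omega, ?_, ?_⟩⟩)
    · have : (n : ℝ) ≤ hi := (Nat.le_floor_iff (hL0.trans (boxLow_le_boxHigh (Nat.cast_nonneg hi) hΔ0 l))).1 h2 |>.trans hHhi
      exact_mod_cast this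
    · exact (Nat.floor_lt hL0).1 h1
    · exact (Nat.le_floor_iff (hL0.trans (boxLow_le_boxHigh (Nat.cast_nonneg hi) hΔ0 l))).1 h2
  have hpiece_on : ∀ n ∈ E,
      moebiusLogPiece j r₀ ⌊boxLow (hi : ℝ) Δ l⌋₊ ⌊boxHigh (hi : ℝ) Δ l⌋₊ n = moebiusLogPiece j r₀ 0 hi n := by
    intro n hn
    obtain ⟨hn1, ⟨hn0, hlo, hhi'⟩⟩ := Finset.mem_filter.1 hn
    have h1 : ⌊boxLow (hi : ℝ) Δ l⌋₊ < n := (Nat.floor_lt hL0).2 hlo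
    have h2 : n ≤ ⌊boxHigh (hi : ℝ) Δ l⌋₊ := Nat.le_floor hhi'
    have h3 : n ≤ hi := (Finset.mem_Icc.1 hn1).2
    unfold moebiusLogPiece
    simp only [h1, h2, hn0, h3, true_and]
  -- restrict the dyadic ranges to the boxes
  symm
  rw [← Finset.sum_subset hKsub]
  · refine Finset.sum_congr rfl fun m hm => ?_
    rw [← Finset.sum_subset hEsub]
    · refine Finset.sum_congr rfl fun n hn => ?_
      rw [if_pos hm, one_mul, hpiece_on n hn]
    · intro n _ hn
      rw [hpiece_off n hn]
      split_ifs <;> simp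
  · intro m _ hm
    refine Finset.sum_eq_zero fun n _ => ?_
    rw [if_neg hm]
    split_ifs <;> simp

end Summit.Parity.BatemanHorn.Theorems
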